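import Mathlib

/-!
# Kernel certificate: the 2-adic square test behind the `𝔭₂`-criterion for the class `c_new = cl(√3 − 1)` of `ℚ(ζ₁₂)`
(P2-MoonenClasses-v2 v1.2 §2; p2-scripts/zeta12_p2criterion.py and zeta12_p2split.gp (kit j244322), 24/24; seat p2, pub-hodge-repro0)

`D` attains `c_new` ⟺ `𝔭₂ = (1+√3)` is not completely split in `K_D/K_D⁺` ⟺ `−β ∉ ℚ₂(√3)^{×2}` (`K_D⁺ = ℚ(√3)(√β)`).
In `ℤ₂[√3]` the uniformiser is `π = 1 + √3` (`(2) = (π)²`, `π² = 2(2 + √3)`), the units are the `x + y√3` with `x + y` odd,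
and `ℤ₂[√3]/(4π) ≅ (ℤ/8 × ℤ/8)/⟨(4, 4)⟩` via `x + y√3 ↦ (x mod 8, y mod 8)` (the ideal `(4π)` is generated by `4 + 4√3` and
`4π√3 = 12 + 4√3 ≡ 4 + 4√3`), with `(x + y√3)² = (x² + 3y²) + 2xy√3`. Certified by `decide`:
* `unit_squares`: the squares of units fall into exactly the two classes `1` and `3` modulo `(4π)` (`1 = 1²`, `3 = (√3)²`);
  by Hensel (units `≡ 1 mod 4π` are squares) these ARE the unit-square classes of `ℚ₂(√3)` — the Hensel direction is not certified;
* `odd_valuation`: for `β ∈ {5+√3, 7+√3, 3+√3, 11+√3, 13+√3}` the norm `a² − 3b²` has `v₂ = 1`, so `v_π(β)` is odd and `−β` is no square;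
* `unit_rows`: for the unit `β` (odd norm) the class of `−β` lies in a unit-square class EXACTLY for the six rows that
  zeta12_p2split.gp finds completely split (`11+4√3`, `m = 5, 7, 15, 23, 13`) and for none of the nine attained rows
  (`4+√3, 8+√3, 14+√3, 5+2√3, 8+3√3, 10+√3, 7+2√3, m = 11, 17`);
* `even_rows`: for `β = m ∈ {2, 6, 10, 14}` (`v_π = 2`, `β/π² = (m/2)(2 − √3)`) the class of `−(m/2)(2 − √3)` is in no
  unit-square class — the four attained even rows.
-/

namespace HodgeRepro0.Zeta12Criterion

/-- the square of `x + y√3` reduced mod `8`: the pair `(x² + 3y² mod 8, 2xy mod 8)` -/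
def sq (x y : Fin 8) : Fin 8 × Fin 8 :=
  (⟨(x.val * x.val + 3 * y.val * y.val) % 8, Nat.mod_lt _ (by decide)⟩,
   ⟨(2 * x.val * y.val) % 8, Nat.mod_lt _ (by decide)⟩)

/-- equality modulo the ideal `(4π) = (4 + 4√3)`: the pairs agree or differ by `(4, 4)` -/
def same (p q : Fin 8 × Fin 8) : Prop :=
  p = q ∨ (p.1 = q.1 + 4 ∧ p.2 = q.2 + 4)

/-- `same` is decidable (it is a disjunction of equalities in `Fin 8`) -/
instance (p q : Fin 8 × Fin 8) : Decidable (same p q) := by unfold same; infer_instance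

/-- the two unit-square classes `1` and `3` -/
def isUnitSquareClass (p : Fin 8 × Fin 8) : Prop :=
  same p ((1 : Fin 8), (0 : Fin 8)) ∨ same p ((3 : Fin 8), (0 : Fin 8))

/-- `isUnitSquareClass` is decidable -/
instance (p : Fin 8 × Fin 8) : Decidable (isUnitSquareClass p) := by unfold isUnitSquareClass; infer_instance

/-- `−β` reduced mod `8` for `β = a + b√3` with `a, b ≥ 0`: the pair `(−a mod 8, −b mod 8)` -/
def negClass (a b : Nat) : Fin 8 × Fin 8 :=
  (⟨(8 - a % 8) % 8, Nat.mod_lt _ (by decide)⟩, ⟨(8 - b % 8) % 8, Nat.mod_lt _ (by decide)⟩)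

/-- the unit squares mod `4π` are exactly the classes `1` and `3` (`x + y√3` a unit ⟺ `x + y` odd) -/
theorem unit_squares : ∀ x y : Fin 8, (x.val + y.val) % 2 = 1 → isUnitSquareClass (sq x y) := by decide

/-- both classes occur: `1 = 1²`, `3 = (√3)²` -/
theorem unit_squares_attained : sq 1 0 = ((1 : Fin 8), (0 : Fin 8)) ∧ sq 0 1 = ((3 : Fin 8), (0 : Fin 8)) := by decide

/-- the five rows of odd `π`-valuation: `v₂(a² − 3b²) = 1` for `β = 5+√3, 7+√3, 3+√3, 11+√3, 13+√3` -/
theorem odd_valuation : ∀ ab ∈ [(5, 1), (7, 1), (3, 1), (11, 1), (13, 1)],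
    (ab.1 * ab.1 - 3 * ab.2 * ab.2 : Int) % 4 = 2 := by decide

/-- the nine attained unit rows: `−β` is in no unit-square class -/
theorem attained_unit_rows : ∀ ab ∈ [(4, 1), (8, 1), (14, 1), (5, 2), (8, 3), (10, 1), (7, 2), (11, 0), (17, 0)],
    ¬ isUnitSquareClass (negClass ab.1 ab.2) := by decide

/-- the six completely split unit rows: `−β` is in a unit-square class (`11+4√3`, `m = 5, 7, 15, 23, 13`) -/
theorem split_unit_rows : ∀ ab ∈ [(11, 4), (5, 0), (7, 0), (15, 0), (23, 0), (13, 0)],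
    isUnitSquareClass (negClass ab.1 ab.2) := by decide

/-- the four attained even rows `m = 2, 6, 10, 14`: with `m = 2m'`, `−β/π² = −m'(2 − √3) = −2m' + m'√3`, whose class
`(−2m' mod 8, m' mod 8)` is in no unit-square class -/
theorem attained_even_rows : ∀ m' ∈ [1, 3, 5, 7],
    ¬ isUnitSquareClass (⟨(8 - (2 * m') % 8) % 8, Nat.mod_lt _ (by decide)⟩, ⟨m' % 8, Nat.mod_lt _ (by decide)⟩) := by
  decide

end HodgeRepro0.Zeta12Criterion
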